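import Summits.ValiantsHypothesis.ValiantsHypothesis.Theorems.GrenetZeonDualUnipotentThreeHalvesWordFlagPencil

/-!
# `GrenetZeon.DualUnipotentThreeHalves` (stmt-ValiantsHypothesis-24318) — line «radical_split» §8 (P-ii), NEGATIVE lane:
# THE FORMAT `(3, 5)` OF R2 IS FALSE — an explicit strictly upper triangular `5 × 5` pencil over `ℂ^{3×3}`

Port (val-lit merged desk, b71 (B) port pool; porter val-port-1 g2; text = val-idea-9 g4's §8, VERBATIM, credited; named
port candidate «P-ii» of val-idea-9 g4's hand-off 2026-08-28 11:55Z) of `Cruxes/DualUnipotentThreeHalves/Lines/radical_split.lean`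
@749d8538785a §8, sub-section «the format (3,5) is FALSE», over the Theorems-side vocabulary (`…WordDefs`: `HeavyTopInst`,
`FlagCheap`, `linPart`, `WordTame`, the witness data `topFive`, `NFive`, `vZero` — definitionally the workfile's) and the
word–flag duality (`…WordFlagPencil.flagCheap_iff_wordTame`, `pow_eq_zero_of_wordTame`).

At `n = 3` every budget is `k ≤ 1`, so a flag-cheap pencil needs square-zero tops on a `K` of dimension `≥ 7` (or zero
tops on dimension `≥ 4`).  The linear pencil `NFive` whose top space is `𝔫₅ ∩ {a₁₅ = 0}` (all `9` coordinates, kernel `0`)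
has none: the square of a top has entries `a₁₂a₂₃` at `(1,3)` and `a₃₄a₄₅` at `(3,5)`, so on `K` one coordinate of each
pair vanishes identically (`forall_apply_eq_zero_or`), `K` is then the `7`-dimensional joint kernel of two coordinates,
contains `e₁₃ + e₃₅`, and `(E₁₃ + E₃₅)² = E₁₅ ≠ 0`.  Hence:

* ★ `not_flagCheap_NFive : ¬ FlagCheap 3 5 NFive`;
* ★★ `not_heavyTopInst_three_five : ¬ HeavyTopInst 3 5` — the instance of R2 at format `(3,5)` is FALSE although `(3,5)`
  is admissible for `C₀ = 1` (`25 < 27`, `format_three_five`); the heavy-top hypothesis is automatic at `n = 3`.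

HONEST LABEL (verbatim from the workfile): **THIS DOES NOT REFUTE R2 `HeavyTopLaw`** (`∃ C₀ n₀, ∀ n ≥ n₀, …` — take
`n₀ ≥ 4`, or `C₀ ≥ 2`, and `(3,5)` is discarded): it is a TINY-`n` ARTEFACT OF THE CONSTANTS — for `16m² ≤ n³` the same
triangular pencils are flag-cheap by ✓ p615665 `flagCheap_of_triangularisable`.  A kernel-checked data point: `C₀ = 1 ∧ n₀ ≤ 3`
is not an admissible parameter choice for R2.  It settles the `m = 5` entry of the `n = 3` column of the instance table
(`m ≤ 3` TRUE by the band, `m = 4 ⟺ SqZeroInSix` — Gerstenhaber's equality case, true in print —, `m ≥ 6` inadmissible).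
`--supports stmt-ValiantsHypothesis-24318` (Negative path); 24318, R2, S3b, rung 8062 and `VP ≠ VNP` are OPEN / NOT moved.
-/

-- `Summit.ValiantsHypothesis.ValiantsHypothesis.…` repeats a component by the D-0017 layout
-- (single-conjunct summit), which the `dupNamespace` linter flags; the name is mandated.
set_option linter.dupNamespace false

noncomputable section

namespace Summit.ValiantsHypothesis.ValiantsHypothesis.Theorems.GrenetZeon.RadicalSplit

open MvPolynomial Matrix
open scoped BigOperators
open Summit.ValiantsHypothesis.ValiantsHypothesis.Cruxes.TwoDimCoefficients.DimTwoCases (AffMat IsAffine)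

variable {m : ℕ}

/-! ## Strictly upper triangular matrices are nilpotent -/

/-- Powers of a strictly upper triangular matrix climb: `(B^k)_{ab} = 0` for `b < a + k`. -/
theorem pow_apply_eq_zero_of_strictUpper {R : Type*} [CommRing R] {d : ℕ} (B : Matrix (Fin d) (Fin d) R)
    (hB : ∀ a b : Fin d, (b : ℕ) ≤ a → B a b = 0) :
    ∀ k : ℕ, ∀ a b : Fin d, (b : ℕ) < a + k → (B ^ k) a b = 0 := by
  intro k
  induction k with
  | zero =>
    intro a b hab
    rw [pow_zero, Matrix.one_apply_ne]
    intro h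
    subst h
    omega
  | succ k ih =>
    intro a b hab
    rw [pow_succ, Matrix.mul_apply]
    refine Finset.sum_eq_zero fun c _ => ?_
    by_cases hc : (c : ℕ) < a + k
    · rw [ih a c hc, zero_mul]
    · rw [hB c b (by omega), mul_zero]

/-- A strictly upper triangular `d × d` matrix has `B^d = 0`. -/
theorem pow_eq_zero_of_strictUpper {R : Type*} [CommRing R] {d : ℕ} (B : Matrix (Fin d) (Fin d) R)
    (hB : ∀ a b : Fin d, (b : ℕ) ≤ a → B a b = 0) : B ^ d = 0 := by
  ext a b
  have hb := b.isLt
  exact pow_apply_eq_zero_of_strictUpper B hB d a b (by omega)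

/-! ## The pencil `NFive`, its values and tops -/

/-- `NFive` is an affine (indeed linear) pencil. -/
theorem isAffine_NFive : IsAffine NFive := by
  intro i j
  fin_cases i <;> fin_cases j <;> simp [NFive, MvPolynomial.totalDegree_X]

/-- `NFive` is strictly upper triangular. -/
theorem NFive_strictUpper : ∀ a b : Fin 5, (b : ℕ) ≤ a → NFive a b = 0 := by
  intro a b h
  fin_cases a <;> fin_cases b <;> simp [NFive] at h ⊢

/-- `NFive` is nilpotent of index `≤ 5`. -/
theorem NFive_pow : NFive ^ 5 = 0 :=
  pow_eq_zero_of_strictUpper NFive NFive_strictUpper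

/-- The values of `NFive`: `N(x) = topFive x`. -/
theorem NFive_map_eval (x : Fin 3 × Fin 3 → ℂ) : NFive.map (MvPolynomial.eval x) = topFive x := by
  ext i j
  fin_cases i <;> fin_cases j <;> simp [NFive, topFive]

/-- The tops of `NFive`: `N_lin(v) = topFive v`. -/
theorem linPart_NFive (v : Fin 3 × Fin 3 → ℂ) : linPart NFive v = topFive v := by
  unfold linPart
  rw [NFive_map_eval, NFive_map_eval]
  ext i j
  fin_cases i <;> fin_cases j <;> simp [topFive]

/-! ## Linear algebra of coordinate subspaces of `ℂ^{3×3}` -/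

/-- On a subspace, a product of two coordinates vanishing identically forces one coordinate to vanish identically. -/
theorem forall_apply_eq_zero_or {ι : Type*} (K : Submodule ℂ (ι → ℂ)) (a b : ι)
    (h : ∀ v ∈ K, v a * v b = 0) : (∀ v ∈ K, v a = 0) ∨ (∀ v ∈ K, v b = 0) := by
  by_contra hc
  push Not at hc
  obtain ⟨⟨u, hu, hua⟩, ⟨w, hw, hwb⟩⟩ := hc
  have hub : u b = 0 := (mul_eq_zero.1 (h u hu)).resolve_left hua
  have hwa : w a = 0 := (mul_eq_zero.1 (h w hw)).resolve_right hwb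
  have huw := h (u + w) (K.add_mem hu hw)
  simp only [Pi.add_apply, hub, hwa, add_zero, zero_add] at huw
  rcases mul_eq_zero.1 huw with h1 | h2
  · exact hua h1
  · exact hwb h2

/-- Two distinct coordinate hyperplanes of `ℂ^{3×3}` meet in dimension `≤ 7`. -/
theorem finrank_ker_inf_ker_le (a b : Fin 3 × Fin 3) (hab : a ≠ b) :
    Module.finrank ℂ ↥(LinearMap.ker (LinearMap.proj a : (Fin 3 × Fin 3 → ℂ) →ₗ[ℂ] ℂ) ⊓
      LinearMap.ker (LinearMap.proj b : (Fin 3 × Fin 3 → ℂ) →ₗ[ℂ] ℂ)) ≤ 7 := by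
  classical
  set Ka := LinearMap.ker (LinearMap.proj a : (Fin 3 × Fin 3 → ℂ) →ₗ[ℂ] ℂ) with hKa
  set Kb := LinearMap.ker (LinearMap.proj b : (Fin 3 × Fin 3 → ℂ) →ₗ[ℂ] ℂ) with hKb
  have hV9 : Module.finrank ℂ (Fin 3 × Fin 3 → ℂ) = 9 := by simp [Module.finrank_fintype_fun_eq_card]
  have h1 : Ka < ⊤ := by
    rw [lt_top_iff_ne_top]
    intro h
    have hmem : (Pi.single a (1 : ℂ) : Fin 3 × Fin 3 → ℂ) ∈ Ka := by rw [h]; trivial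
    rw [hKa, LinearMap.mem_ker, LinearMap.proj_apply] at hmem
    simp at hmem
  have h2 : Ka ⊓ Kb < Ka := by
    refine lt_of_le_of_ne inf_le_left fun h => ?_
    have hmem : (Pi.single b (1 : ℂ) : Fin 3 × Fin 3 → ℂ) ∈ Ka := by
      rw [hKa, LinearMap.mem_ker, LinearMap.proj_apply, Pi.single_eq_of_ne hab]
    rw [← h] at hmem
    have hmem' : (Pi.single b (1 : ℂ) : Fin 3 × Fin 3 → ℂ) ∈ Kb := (Submodule.mem_inf.1 hmem).2
    rw [hKb, LinearMap.mem_ker, LinearMap.proj_apply] at hmem'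
    simp at hmem'
  have h3 := Submodule.finrank_lt_finrank_of_lt h1
  have h4 := Submodule.finrank_lt_finrank_of_lt h2
  rw [finrank_top, hV9] at h3
  omega

/-- `(topFive vZero)² = E₁₅ ≠ 0`. -/
theorem topFive_vZero_sq_ne_zero : topFive vZero * topFive vZero ≠ 0 := by
  intro h
  have h04 := congr_fun (congr_fun h 0) 4
  simp [topFive, vZero, Matrix.mul_apply, Fin.sum_univ_five] at h04

/-! ## The verdict at format `(3, 5)` -/

/-- **`NFive` is not flag-cheap at `n = 3`.** [this file] -/
theorem not_flagCheap_NFive : ¬ FlagCheap 3 5 NFive := by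
  classical
  rw [flagCheap_iff_wordTame NFive isAffine_NFive]
  rintro ⟨K, k, hdim, hW⟩
  have hV9 : Module.finrank ℂ (Fin 3 × Fin 3 → ℂ) = 9 := by simp [Module.finrank_fintype_fun_eq_card]
  have hKle : Module.finrank ℂ K ≤ 9 := by
    have h1 := Submodule.finrank_le K
    omega
  have hk1 : k ≤ 1 := by
    by_contra hk
    have : 3 * 3 ≤ (k + 1) * 3 := Nat.mul_le_mul_right 3 (by omega)
    omega
  -- tops on `K` have index ≤ k + 1
  have hpow : ∀ v ∈ K, topFive v ^ (k + 1) = 0 := fun v hv => by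
    rw [← linPart_NFive]
    exact pow_eq_zero_of_wordTame (by omega) _ _ (hW 0 v hv)
  rcases Nat.le_one_iff_eq_zero_or_eq_one.1 hk1 with rfl | rfl
  · -- budget 0: tops vanish on K, so K = ⊥
    have hK : K = ⊥ := by
      rw [Submodule.eq_bot_iff]
      intro v hv
      have h0 : topFive v = 0 := by simpa using hpow v hv
      funext c
      obtain ⟨i, j⟩ := c
      fin_cases i <;> fin_cases j
      · simpa [topFive] using congr_fun (congr_fun h0 0) 1
      · simpa [topFive] using congr_fun (congr_fun h0 0) 2
      · simpa [topFive] using congr_fun (congr_fun h0 0) 3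
      · simpa [topFive] using congr_fun (congr_fun h0 1) 2
      · simpa [topFive] using congr_fun (congr_fun h0 1) 3
      · simpa [topFive] using congr_fun (congr_fun h0 1) 4
      · simpa [topFive] using congr_fun (congr_fun h0 2) 3
      · simpa [topFive] using congr_fun (congr_fun h0 2) 4
      · simpa [topFive] using congr_fun (congr_fun h0 3) 4
    rw [hK, finrank_bot] at hdim
    omega
  · -- budget 1: square-zero tops on K with dim K ≥ 7
    have hsq : ∀ v ∈ K, topFive v * topFive v = 0 := fun v hv => by
      simpa [pow_succ] using hpow v hv
    have e02 : ∀ v ∈ K, v (0,0) * v (1,0) = 0 := fun v hv => by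
      simpa [topFive, Matrix.mul_apply, Fin.sum_univ_five] using congr_fun (congr_fun (hsq v hv) 0) 2
    have e24 : ∀ v ∈ K, v (2,0) * v (2,2) = 0 := fun v hv => by
      simpa [topFive, Matrix.mul_apply, Fin.sum_univ_five] using congr_fun (congr_fun (hsq v hv) 2) 4
    -- the uniform finish: two vanishing coordinates `a ≠ b` off the support of `vZero` put `vZero` in `K`
    have key : ∀ a b : Fin 3 × Fin 3, a ≠ b → vZero a = 0 → vZero b = 0 →
        (∀ v ∈ K, v a = 0) → (∀ v ∈ K, v b = 0) → False := by
      intro a b hab ha0 hb0 hKa hKb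
      have hKL : K ≤ LinearMap.ker (LinearMap.proj a : (Fin 3 × Fin 3 → ℂ) →ₗ[ℂ] ℂ) ⊓
          LinearMap.ker (LinearMap.proj b : (Fin 3 × Fin 3 → ℂ) →ₗ[ℂ] ℂ) := fun v hv => by
        rw [Submodule.mem_inf, LinearMap.mem_ker, LinearMap.mem_ker, LinearMap.proj_apply, LinearMap.proj_apply]
        exact ⟨hKa v hv, hKb v hv⟩
      have hKeq := Submodule.eq_of_le_of_finrank_le hKL
        (by have := finrank_ker_inf_ker_le a b hab; omega)
      have hv0 : vZero ∈ K := by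
        rw [hKeq, Submodule.mem_inf, LinearMap.mem_ker, LinearMap.mem_ker, LinearMap.proj_apply, LinearMap.proj_apply]
        exact ⟨ha0, hb0⟩
      exact topFive_vZero_sq_ne_zero (hsq vZero hv0)
    rcases forall_apply_eq_zero_or K (0,0) (1,0) e02 with hA | hA <;>
      rcases forall_apply_eq_zero_or K (2,0) (2,2) e24 with hB | hB
    · exact key (0,0) (2,0) (by decide) (by simp [vZero]) (by simp [vZero]) hA hB
    · exact key (0,0) (2,2) (by decide) (by simp [vZero]) (by simp [vZero]) hA hB
    · exact key (1,0) (2,0) (by decide) (by simp [vZero]) (by simp [vZero]) hA hB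
    · exact key (1,0) (2,2) (by decide) (by simp [vZero]) (by simp [vZero]) hA hB

/-- **The format `(3, 5)` of R2 is FALSE** (admissible for `C₀ = 1`: `25 < 27`; the heavy-top hypothesis is automatic at `n = 3`).
NOT a refutation of `HeavyTopLaw` (which may take `n₀ ≥ 4` or `C₀ ≥ 2`); a kernel-checked data point: `C₀ = 1 ∧ n₀ ≤ 3` is not an
admissible parameter choice for R2. [this file] -/
theorem not_heavyTopInst_three_five : ¬ HeavyTopInst 3 5 := by
  intro h
  have hV9 : Module.finrank ℂ (Fin 3 × Fin 3 → ℂ) = 9 := by simp [Module.finrank_fintype_fun_eq_card]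
  refine not_flagCheap_NFive (h NFive isAffine_NFive NFive_pow fun K _ => ?_)
  have h1 := Submodule.finrank_le K
  omega

/-- Format bookkeeping: `(3,5)` is admissible for `C₀ = 1` (`25 < 27`), `(3,6)` is not. -/
theorem format_three_five : 1 * 5 ^ 2 < 3 ^ 3 ∧ ¬ (1 * 6 ^ 2 < 3 ^ 3) := by decide

end Summit.ValiantsHypothesis.ValiantsHypothesis.Theorems.GrenetZeon.RadicalSplit

end
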